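import Mathlib.Algebra.CharP.Defs
import Mathlib.FieldTheory.Separable
import Mathlib.GroupTheory.QuotientGroup.Defs
import Mathlib.LinearAlgebra.Matrix.Charpoly.Basic
import Mathlib.LinearAlgebra.Matrix.Trace
import Mathlib.RepresentationTheory.Homological.GroupCohomology.LowDegree
import Mathlib.RepresentationTheory.Subrepresentation
import Mathlib.SetTheory.Cardinal.Finite
import HarnessLib

/-!
# Enormous subgroups of `GL_n(k)` (Allen–Calegari–Caraiani–Gee–Helm–Le Hung–Newton–Scholze–Taylor–Thorne, Def. 6.2.28)

Topic `NumberTheory/GaloisRepresentations`.  Let `k` be a field of characteristic `p`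
(printed: "any algebraic extension of `𝔽_p`") and `H ≤ GL_n(k)` a subgroup.  ACC+
(*Potential automorphy over CM fields*, Ann. of Math. 197 (2023) = arXiv:1812.09999),
Definition 6.2.28, as printed:

> Let `ad⁰` denote the space of trace zero matrices in `M_{n×n}(k)` with the adjoint
> `GL_n(k)`-action.  An absolutely irreducible subgroup `H ⊆ GL_n(k)` is called *enormous over
> `k`* if it satisfies the following: (1) `H` has no nontrivial `l`-power order quotient.
> (2) `H⁰(H, ad⁰) = H¹(H, ad⁰) = 0`.  (3) For any simple `k[H]`-submodule `W ⊆ ad⁰`, there is a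
> regular semisimple `h ∈ H` such that `W^h ≠ 0`.

(In (1) the printed `l` is the residue characteristic `p` of `k` — the only prime in the
context of §6.2; the next use, in the proof of Lemma 6.2.31, reads "since `H` has no `p`-power
order quotients"; and the source definition, Khare–Thorne, *Potential automorphy and the
Leopoldt conjecture*, Def. 4.10 (arXiv:1409.7007 numbering; cited as [KT] in Remark 6.2.30,
read 2026-08-15), has "`H` has no non-trivial `p`-power order quotient".)  "Note that this only depends on the image of `H` in
`PGL_n(k)`. If `p` divides `n`, then no subgroup of `GL_n(k)` is enormous (because `ad⁰` contains
the scalar matrices)."  By Lemma 6.2.29 the notion does not depend on the algebraic extension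
`k'/k` ("Henceforth we drop the 'over `k`'").  This is hypothesis (iii) of Qian, *Potential
automorphy for `GL_n`*, Invent. Math. 231 (2023), Thm. 1.4 ("the image of `r̄|_{G_{F(ζ_l)}}` is
enormous"), requested by route `SelfDefeatingInduction` (summit `Langlands`).

## Main definitions

* `glAdjointRepresentation n k : Representation k (GL n k) (Matrix n n k)` — the adjoint action
  `g • M = g M g⁻¹` (Mathlib `LinearMap.mulLeftRight`); `adZero n k` — **`ad⁰`**, the
  subrepresentation (Mathlib `Subrepresentation`) of trace-zero matrices
  (`LinearMap.ker (Matrix.traceLinearMap …)`, stable by `Matrix.trace_mul_cycle`);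
  `Subgroup.adZeroRep H : Representation k H ad⁰` — its restriction to a subgroup `H`.
* `IsRegularSemisimple g` — `g ∈ GL_n(k)` is **regular semisimple**: its characteristic
  polynomial is separable (Mathlib `Polynomial.Separable`), i.e. `g` has `n` distinct
  eigenvalues in `k̄` (equivalently: `g` is diagonalisable over `k̄` with pairwise distinct
  eigenvalues, the usual meaning of "regular semisimple" in `GL_n`).
* `Subgroup.IsEnormous H` — **`H` is enormous**: the three conditions of Def. 6.2.28 verbatim —
  (1) every quotient `H ⧸ N` of order `p^a`, `p = ringChar k`, has `a = 0`
  (`Nat.card`, so only finite quotients count, as in "order"); (2) `(ad⁰)^H = 0` (Mathlib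
  `Representation.invariants`, which is `H⁰` by Mathlib `groupCohomology.H0Iso`) and every
  `1`-cocycle `H → ad⁰` is a `1`-coboundary (Mathlib `groupCohomology.cocycles₁ ≤ coboundaries₁`
  for `Rep.of (adZeroRep H)`, which is `H¹ = 0` by Mathlib `groupCohomology.H1π_eq_zero_iff`,
  see `Subgroup.IsEnormous.subsingleton_H1`); (3) for every simple `k[H]`-submodule `W ⊆ ad⁰`
  (an atom of the lattice `Subrepresentation (adZeroRep H)`, Mathlib `IsAtom`) there is a
  regular semisimple `h ∈ H` with `W^h ≠ 0` (a non-zero `w ∈ W` with `h w h⁻¹ = w`).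
* API: unfolding lemmas, `Subgroup.IsEnormous.subsingleton_H1` (clause (2) gives
  `H¹(H, ad⁰) = 0` in Mathlib's `groupCohomology.H1`), and the printed remark
  `Subgroup.not_isEnormous_of_natCast_eq_zero`: if `p ∣ n` (`n ≥ 1`) no subgroup is enormous.

## Design

* **Absolute irreducibility is not a clause.**  ACC+ predicate the term of "an absolutely
  irreducible subgroup `H`"; the three conditions make sense for every subgroup and, as in the
  source definition (Khare–Thorne, Def. 4.10: "We say that a subgroup `H ⊂ GL_n(k)` is enormous
  if it satisfies the following conditions", the same (1), (2) and the eigen-projection form of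
  (3)), `IsEnormous` is defined by them alone.  Statements vendoring a hypothesis "`ρ̄(Γ)` is
  enormous (ACC+ Def. 6.2.28)" add the absolute irreducibility of `ρ̄|_Γ` next to it when they
  want ACC+'s sentence literally (so does the tree's `Qian2022.potentialAutomorphy_ordinary`).
* `H` is a `Subgroup (GL (Fin n) k)` and the predicates are declared as
  `Literature.NumberTheory.GaloisRepresentations.Subgroup.IsEnormous` etc. (inside the topic
  namespace, not Mathlib's root `Subgroup` namespace; write `Subgroup.IsEnormous H` after
  `open Literature.NumberTheory.GaloisRepresentations`).
* Group cohomology is taken in Mathlib's inhomogeneous-cochain model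
  (`groupCohomology.cocycles₁`: `f (g * h) = g • f h + f g`; `coboundaries₁`: `g ↦ g • m - m`),
  for the bundled `Rep.of (adZeroRep H)`; this needs `k` and `H` in the same universe, which
  holds (`H` is a subgroup of `GL_n(k)`).
* The variant (3′) of Khare–Thorne / Thorne's "adequate" — "a regular semisimple `h` and an
  eigenvalue `α ∈ k` of `h` with `tr(e_{h,α} W) ≠ 0`" — is equivalent to (3) when `k` contains
  the eigenvalues of all elements of `H` (ACC+ Remark 6.2.30); only the printed ACC+ form is
  defined here.
* NOT here (wanted API recorded on the definition item, each a separate result): invariance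
  under `k'/k` (Lemma 6.2.29), the examples `H ⊇ SL_n(k₀)` (ACC+ Lemma 6.2.x / [KT]), and the
  imprimitive case of route item `InducedImageEnormous`.

## References

* [ACCGHLNSTT2023] P. Allen, F. Calegari, A. Caraiani, T. Gee, D. Helm, B. Le Hung, J. Newton,
  P. Scholze, R. Taylor, J. Thorne, *Potential automorphy over CM fields*, Ann. of Math. 197
  (2023), Def. 6.2.28, Lemma 6.2.29, Rem. 6.2.30 (held: arXiv:1812.09999, §6.2.9).
* [Qian2022] L. Qian, *Potential automorphy for `GL_n`*, Invent. Math. 231 (2023), Thm. 1.4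
  (held: arXiv:2104.09761, p. 2).
* [KhareThorne2017] C. Khare, J. Thorne, *Potential automorphy and the Leopoldt conjecture*,
  Amer. J. Math. 139 (2017), Def. 4.10 of arXiv:1409.7007 ("enormous", with clause (3) in the
  eigen-projection form `tr(e_{h,α} W) ≠ 0`; "an enormous subgroup is big"; held).
-/

noncomputable section

open scoped MatrixGroups

namespace Literature.NumberTheory.GaloisRepresentations

universe u

/-! ### The adjoint representation and `ad⁰` -/

section Adjoint

variable (n : Type) [Fintype n] [DecidableEq n] (k : Type u) [Field k]

/-- The **adjoint representation** of `GL_n(k)` on `M_{n×n}(k)`: `g • M = g M g⁻¹`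
(Mathlib `LinearMap.mulLeftRight k (g, g⁻¹)`). [cite: ACCGHLNSTT2023, Def. 6.2.28] -/
def glAdjointRepresentation : Representation k (GL n k) (Matrix n n k) where
  toFun g := LinearMap.mulLeftRight k
    (((g : GL n k) : Matrix n n k), ((g⁻¹ : GL n k) : Matrix n n k))
  map_one' := by
    ext M : 1
    simp
  map_mul' g h := by
    ext M : 1
    simp only [LinearMap.mulLeftRight_apply, Module.End.mul_apply, mul_inv_rev, Units.val_mul,
      Matrix.mul_assoc]

/-- Unfolding lemma: `glAdjointRepresentation n k g M = g * M * g⁻¹`. [folklore] -/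
@[simp] lemma glAdjointRepresentation_apply (g : GL n k) (M : Matrix n n k) :
    glAdjointRepresentation n k g M =
      ((g : GL n k) : Matrix n n k) * M * ((g⁻¹ : GL n k) : Matrix n n k) := rfl

/-- The adjoint action preserves the trace: `tr(g M g⁻¹) = tr(M)` (Mathlib
`Matrix.trace_mul_cycle`). [folklore] -/
lemma trace_glAdjointRepresentation (g : GL n k) (M : Matrix n n k) :
    (glAdjointRepresentation n k g M).trace = M.trace := by
  rw [glAdjointRepresentation_apply, Matrix.trace_mul_cycle, Units.inv_mul, Matrix.one_mul]

/-- **`ad⁰`**: "the space of trace zero matrices in `M_{n×n}(k)` with the adjoint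
`GL_n(k)`-action", as a subrepresentation of the adjoint representation (underlying submodule
`ker (trace)`). [cite: ACCGHLNSTT2023, Def. 6.2.28] -/
def adZero : Subrepresentation (glAdjointRepresentation n k) where
  toSubmodule := LinearMap.ker (Matrix.traceLinearMap n k k)
  apply_mem_toSubmodule g M hM := by
    simp only [LinearMap.mem_ker, Matrix.traceLinearMap_apply] at hM ⊢
    rw [trace_glAdjointRepresentation, hM]

variable {n k}

/-- Membership in `ad⁰`: `M ∈ ad⁰ ↔ tr M = 0`. [folklore] -/
@[simp] lemma mem_adZero_iff (M : Matrix n n k) : M ∈ adZero n k ↔ M.trace = 0 := Iff.rfl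

/-- Membership in the underlying submodule of `ad⁰`. [folklore] -/
@[simp] lemma mem_adZero_toSubmodule_iff (M : Matrix n n k) :
    M ∈ (adZero n k).toSubmodule ↔ M.trace = 0 := Iff.rfl

end Adjoint

/-! ### Regular semisimple elements and the representation of a subgroup on `ad⁰` -/

section Subgroup

variable {k : Type u} [Field k] {n : ℕ}

/-- `g ∈ GL_n(k)` is **regular semisimple**: its characteristic polynomial is separable, i.e.
has `n` pairwise distinct roots in an algebraic closure `k̄` — equivalently `g` is
diagonalisable over `k̄` with pairwise distinct eigenvalues (semisimple with centraliser a
maximal torus). [folklore] -/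
def IsRegularSemisimple (g : GL (Fin n) k) : Prop :=
  ((g : GL (Fin n) k) : Matrix (Fin n) (Fin n) k).charpoly.Separable

/-- Unfolding lemma for `IsRegularSemisimple`. [folklore] -/
lemma isRegularSemisimple_iff (g : GL (Fin n) k) :
    IsRegularSemisimple g ↔ ((g : GL (Fin n) k) : Matrix (Fin n) (Fin n) k).charpoly.Separable :=
  Iff.rfl

/-- The representation of a subgroup `H ≤ GL_n(k)` on `ad⁰` (restriction of the adjoint action
to `H`, on the trace-zero matrices): the `k[H]`-module `ad⁰` of Def. 6.2.28.  Declared as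
`….GaloisRepresentations.Subgroup.adZeroRep` (topic namespace, not Mathlib's `Subgroup`).
[cite: ACCGHLNSTT2023, Def. 6.2.28] -/
abbrev Subgroup.adZeroRep (H : Subgroup (GL (Fin n) k)) :
    Representation k H (adZero (Fin n) k).toSubmodule :=
  (adZero (Fin n) k).toRepresentation.comp H.subtype

/-- Unfolding lemma: `h ∈ H` acts on `M ∈ ad⁰` by `h M h⁻¹`. [folklore] -/
@[simp] lemma Subgroup.coe_adZeroRep_apply (H : Subgroup (GL (Fin n) k)) (h : H)
    (M : (adZero (Fin n) k).toSubmodule) :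
    ((Subgroup.adZeroRep H h M : (adZero (Fin n) k).toSubmodule) : Matrix (Fin n) (Fin n) k) =
      (((h : GL (Fin n) k)) : Matrix (Fin n) (Fin n) k) * (M : Matrix (Fin n) (Fin n) k) *
        ((((h : GL (Fin n) k))⁻¹ : GL (Fin n) k) : Matrix (Fin n) (Fin n) k) :=
  rfl

/-! ### Enormous subgroups -/

/-- **`H ≤ GL_n(k)` is enormous** (ACC+ 2023, Def. 6.2.28: conditions (1)–(3) verbatim; ACC+
state them for an absolutely irreducible `H`, which is NOT made a clause here — module
docstring, "Design").  With `p = ringChar k` and `ad⁰` the trace-zero matrices under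
`h • M = h M h⁻¹` (`Subgroup.adZeroRep H`):
* `eq_zero_of_card_quotient` — (1) "`H` has no nontrivial `p`-power order quotient": a quotient
  `H ⧸ N` (by a normal subgroup) of order `p ^ a` has `a = 0`;
* `invariants_eq_bot` — (2a) `H⁰(H, ad⁰) = (ad⁰)^H = 0`;
* `cocycles₁_le_coboundaries₁` — (2b) `H¹(H, ad⁰) = 0`: every inhomogeneous `1`-cocycle is a
  `1`-coboundary (Mathlib `groupCohomology.cocycles₁`, `coboundaries₁`);
* `exists_isRegularSemisimple` — (3) for every simple `k[H]`-submodule `W ⊆ ad⁰` (an atom of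
  the lattice of subrepresentations) there is a regular semisimple `h ∈ H` with `W^h ≠ 0`.
Declared as `….GaloisRepresentations.Subgroup.IsEnormous` (topic namespace).  Intended for `k`
an algebraic extension of `𝔽_p` (then independent of `k`, ACC+ Lemma 6.2.29).
[cite: ACCGHLNSTT2023, Def. 6.2.28] -/
structure Subgroup.IsEnormous (H : Subgroup (GL (Fin n) k)) : Prop where
  /-- (1) no non-trivial quotient of `p`-power order, `p = ringChar k`. -/
  eq_zero_of_card_quotient :
    ∀ (N : Subgroup H) [N.Normal] (a : ℕ), Nat.card (H ⧸ N) = ringChar k ^ a → a = 0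
  /-- (2a) `H⁰(H, ad⁰) = 0`. -/
  invariants_eq_bot : (Subgroup.adZeroRep H).invariants = ⊥
  /-- (2b) `H¹(H, ad⁰) = 0`. -/
  cocycles₁_le_coboundaries₁ :
    groupCohomology.cocycles₁ (Rep.of (Subgroup.adZeroRep H)) ≤
      groupCohomology.coboundaries₁ (Rep.of (Subgroup.adZeroRep H))
  /-- (3) every simple `k[H]`-submodule of `ad⁰` has non-zero invariants under some regular
  semisimple element of `H`. -/
  exists_isRegularSemisimple :
    ∀ W : Subrepresentation (Subgroup.adZeroRep H), IsAtom W →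
      ∃ h : H, IsRegularSemisimple (h : GL (Fin n) k) ∧
        ∃ w ∈ W, w ≠ 0 ∧ Subgroup.adZeroRep H h w = w

namespace Subgroup.IsEnormous

variable {H : Subgroup (GL (Fin n) k)}

/-- Clause (2b) in Mathlib's group cohomology: for an enormous `H`, `H¹(H, ad⁰)`
(`groupCohomology.H1`) is zero (every class is represented by a cocycle, `H1_induction_on`,
and a cocycle maps to `0` iff it is a coboundary, `H1π_eq_zero_iff`). [folklore] -/
theorem subsingleton_H1 (hH : Subgroup.IsEnormous H) :
    Subsingleton (groupCohomology.H1 (Rep.of (Subgroup.adZeroRep H))) := by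
  refine ⟨fun x y => ?_⟩
  have h0 : ∀ z : groupCohomology.H1 (Rep.of (Subgroup.adZeroRep H)), z = 0 := by
    intro z
    induction z using groupCohomology.H1_induction_on with
    | h f =>
      rw [groupCohomology.H1π_eq_zero_iff]
      exact hH.cocycles₁_le_coboundaries₁ f.2
  rw [h0 x, h0 y]

/-- Clause (2a) elementwise: an `H`-invariant trace-zero matrix is `0`. [folklore] -/
theorem eq_zero_of_forall_apply_eq (hH : Subgroup.IsEnormous H)
    {M : (adZero (Fin n) k).toSubmodule} (hM : ∀ h : H, Subgroup.adZeroRep H h M = M) :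
    M = 0 := by
  have : M ∈ (Subgroup.adZeroRep H).invariants := (Representation.mem_invariants _ M).2 hM
  rw [hH.invariants_eq_bot] at this
  exact (Submodule.mem_bot k).1 this

end Subgroup.IsEnormous

/-- **"If `p` divides `n`, then no subgroup of `GL_n(k)` is enormous (because `ad⁰` contains the
scalar matrices)"** (ACC+, after Def. 6.2.28), for `n ≥ 1`: if `n = 0` in `k` then the identity
matrix is a non-zero `H`-invariant element of `ad⁰`, contradicting (2a).  (For `n = 0` the
trivial subgroup of `GL_0` satisfies (1)–(3) vacuously.)
[cite: ACCGHLNSTT2023, §6.2.9 (after Def. 6.2.28)] -/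
theorem Subgroup.not_isEnormous_of_natCast_eq_zero (H : Subgroup (GL (Fin n) k))
    (hn : (n : k) = 0) (hn0 : 0 < n) : ¬ Subgroup.IsEnormous H := by
  intro hH
  -- the identity matrix is a non-zero `H`-invariant element of `ad⁰`
  have h1 : (1 : Matrix (Fin n) (Fin n) k) ∈ (adZero (Fin n) k).toSubmodule := by
    rw [mem_adZero_toSubmodule_iff, Matrix.trace_one, Fintype.card_fin, hn]
  have hfix : ∀ h : H, Subgroup.adZeroRep H h ⟨1, h1⟩ = ⟨1, h1⟩ := by
    intro h
    ext1
    change (((h : GL (Fin n) k)) : Matrix (Fin n) (Fin n) k) * 1 *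
        ((((h : GL (Fin n) k))⁻¹ : GL (Fin n) k) : Matrix (Fin n) (Fin n) k) = 1
    rw [Matrix.mul_one, Units.mul_inv]
  have h0 := hH.eq_zero_of_forall_apply_eq hfix
  have h0' : (1 : Matrix (Fin n) (Fin n) k) = 0 := congrArg Subtype.val h0
  haveI : Nonempty (Fin n) := ⟨⟨0, hn0⟩⟩
  exact one_ne_zero h0'

end Subgroup

end Literature.NumberTheory.GaloisRepresentations
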